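import Mathlib
import Summits.ValiantsHypothesis.ValiantsHypothesis.Theses.FifoMatching
import Summits.ValiantsHypothesis.ValiantsHypothesis.Theorems.FifoMatchingNNInternalCofactorQuasiPolyHardOfAvoidingCounts
import Summits.ValiantsHypothesis.ValiantsHypothesis.Theorems.FifoMatchingNNLinearDegreeCofactorHard
import HarnessLib

/-!
# Route `FifoMatching` — support `NNInternalCofactorQuasiPolyHard` (stmt-ValiantsHypothesis-24468, SPEC §S11, exponent 2): PROOF

S11: `NN_n` stays `2^{Ω(log² n)}`-hard in the monotone model after multiplication by ANY nonzero INTERNAL cofactor `p`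
(support inside `R × R`) at linear defect density: `∃ a b n₀, 0 < b ∧ ∀ n ≥ n₀, ∀ R, a·#R ≤ 2n → ∀ p ≠ 0 internal,
2^((log₂ n)²/b) < L₊(NN_n · p)` (here `a = 1024`, `b = 1`).

Closing ONE-LINER BY NAME (c1 g1, the closers' filer of record, director-valiant R99 (b) / R106 (b)) over LANDED files only:

* val-idea-7 g5's a-fortiori glue `AFortiori.nnInternalCofactorQuasiPolyHard_of_pricing a ha r hμ hr` (p606451): S11 follows from the
  SAME pricing hypothesis through which the ∀c crux `NNLinearDegreeCofactorHard` (stmt-23918) was closed — dense branch by p3's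
  degree-free `InternalCofactor.lt_complexity_of_counts`, long-run branch by S2a `stub_longRunInternalHard`, both at `c = 2`;
* the acting LEAD p1 g2's μ* = `shedWord` pricing `ShedWord.hμ_shedWord` and rate growth `ShedWord.rate_hrate` (p606802, the closing
  file of stmt-23918, over `ShedWord.pricing_large` / `pricing_small` p606595 and the 25 helper files of the line `internal_cofactor`),
  with LEAD p2 g0's `hr_of_root` (p603556) — the IDENTICAL arguments p1 fed to `InternalCofactor.avoidingCounts_of_pricing 1024`.

Credit of record: μ* (design, band, heart, gates, pricing, measure, 23918 closing) p1 g2; line / interface / rate LEAD p2 g0; carving,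
counts glue, tight heart, adversary round p3 g0; earlier leads p4 g0 / p5 g0; a-fortiori observation + registered line val-idea-7 g5;
this file only composes.  Honest framing: a MONOTONE rung (over `ℝ≥0`, `L₊ = complexity`) of the conditional route `FifoMatching`;
`NNDivisionHard`, `NNNotVP` stay OPEN; monotone ≠ general (`Literature.Barriers.ValiantsHypothesis.MonotoneGap`); NOTHING here is
progress on VP ≠ VNP (NOT proved).  No definitions, no named facts. [folklore]
-/

noncomputable section

-- Sub = Summit single-conjunct layout: the duplicated namespace component is mandated by the tree.
set_option linter.dupNamespace false

namespace Summit.ValiantsHypothesis.ValiantsHypothesis.Theorems.FifoMatching.NNInternalCofactorQuasiPolyHard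

open Summit.ValiantsHypothesis.ValiantsHypothesis.Theorems.FifoMatching.NNLinearDegreeCofactorHard
open Summit.ValiantsHypothesis.ValiantsHypothesis.Theorems.FifoMatching.NNLinearDegreeCofactorHard.InternalCofactor
open Summit.ValiantsHypothesis.ValiantsHypothesis.Theorems.FifoMatching.NNLinearDegreeCofactorHard.ShedWord

/-- **`NNInternalCofactorQuasiPolyHard` (S11, stmt-ValiantsHypothesis-24468 of route `FifoMatching`), PROVED** — BY NAME: the
a-fortiori glue at density `a = 1024` fed with exactly the μ* pricing (`hμ_shedWord`) and rate (`hr_of_root _ 64 16 (2^191) _ rate_hrate`,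
rate `M ↦ 0` below `2M < 2^192`, else `root16 (2M) / 32`) that closed stmt-23918.  Monotone world only; VP ≠ VNP NOT proved. [folklore] -/
theorem NNInternalCofactorQuasiPolyHard_proof :
    Summit.ValiantsHypothesis.ValiantsHypothesis.Theses.FifoMatching.NNInternalCofactorQuasiPolyHard :=
  AFortiori.nnInternalCofactorQuasiPolyHard_of_pricing 1024 (by norm_num)
    (fun M => if 2 * M < 2 ^ 192 then 0 else root16 (2 * M) / 32)
    hμ_shedWord (hr_of_root _ 64 16 (2 ^ 191) (by norm_num) rate_hrate)

end Summit.ValiantsHypothesis.ValiantsHypothesis.Theorems.FifoMatching.NNInternalCofactorQuasiPolyHard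

end
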